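import Summits.ValiantsHypothesis.ValiantsHypothesis.Theorems.SymmetroidDescartesRolleToDescartes

/-!
# The convexity-bump realisation lemma (support for the construction item `TriangularClassManyRoots`)

Negative-side support lemma for crux `stmt-ValiantsHypothesis-18500` (`DerivedPencilRolle`), cdisprove seat,
2026-08-17.  Pure real analysis, no graphs: it is Step 3 of the paper refutation in
`Cruxes/DerivedPencilRolle/Disproof.lean` §B, isolated so that the construction item reduces to combinatorics
(exhibiting path systems with many tropical breakpoints, Carstensen / Mulmuley–Shah / Gajjar–Radhakrishnan) plus
the Hessenberg path-sum identity.

Data: finitely many affine functions `ℓ_i(s) = γ_i + s·w_i` with NATURAL slopes `w_i` (think: the monomials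
`e^{Λγ_i} t^{Λ w_i}` of a positive lacunary polynomial / the paths of a positive ABP, `t = e^s`).
`trop s = max_i ℓ_i(s)`; `s` is a BREAKPOINT if two maximisers at `s` have different slopes;
`psum Λ s = Σ_i exp(Λ ℓ_i(s))` (`= f_A(e^s)`).

* `exp_trop_le_psum`, `psum_le_card_mul_exp_trop` : `e^{Λ L} ≤ F_Λ ≤ |ι| e^{Λ L}`;
* `two_trop_add_le_of_isBreakpoint` : at a breakpoint the second difference of `L` at scale `η` is `≥ η`;
* `exists_affine_of_free` : on a breakpoint-free closed interval `L` is one of the lines (finite descent on crossing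
  abscissae — no topology);
* `bump_neg_of_isBreakpoint`, `bump_pos_of_free` : with `4 log|ι| < Λη`, the bump
  `F_Λ(s)² − e^{−Λη/2} F_Λ(s+η) F_Λ(s−η)` is NEGATIVE at every breakpoint and POSITIVE at every point whose
  `η`-window is breakpoint-free.
Hence along any interlacing sequence (free point, breakpoint, free point, …) the bump alternates in sign, and the
tree lemma `le_card_posRoots_of_alternating` turns `N` breakpoints into `2N` distinct positive roots of the
polynomial `f_A(t)² − e^{−Λη/2} f_A(e^{η}t) f_A(e^{−η}t)` (`Λ ∈ ℕ`).  [folklore-level real analysis; the use is new]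
-/

-- `Summit.ValiantsHypothesis.ValiantsHypothesis.…` repeats a component by the D-0017 layout
-- (single-conjunct summit), which the `dupNamespace` linter flags; the name is mandated.
set_option linter.dupNamespace false

namespace Summit.ValiantsHypothesis.ValiantsHypothesis.Theorems.DerivedPencilRolle.Negative

open scoped BigOperators
open Real

variable {ι : Type*} [Fintype ι] [Nonempty ι]

/-- the affine function `ℓ_i(s) = γ_i + s·w_i` -/
def line (γ : ι → ℝ) (w : ι → ℕ) (i : ι) (s : ℝ) : ℝ := γ i + s * (w i : ℝ)

/-- the tropicalisation `L(s) = max_i ℓ_i(s)` -/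
noncomputable def trop (γ : ι → ℝ) (w : ι → ℕ) (s : ℝ) : ℝ :=
  Finset.univ.sup' Finset.univ_nonempty (fun i => line γ w i s)

/-- `s` is a breakpoint of `L`: two maximisers with different slopes -/
def IsBreakpoint (γ : ι → ℝ) (w : ι → ℕ) (s : ℝ) : Prop :=
  ∃ i j, w i < w j ∧ line γ w i s = trop γ w s ∧ line γ w j s = trop γ w s

/-- the positive sum `F_Λ(s) = Σ_i exp(Λ ℓ_i(s))` (`= f_A(e^s)` for the positive lacunary polynomial
`f_A(t) = Σ_i e^{Λγ_i} t^{Λ w_i}`) -/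
noncomputable def psum (γ : ι → ℝ) (w : ι → ℕ) (Λ s : ℝ) : ℝ := ∑ i, Real.exp (Λ * line γ w i s)

section Basic

variable (γ : ι → ℝ) (w : ι → ℕ)

/-- every line is below the max -/
theorem line_le_trop (i : ι) (s : ℝ) : line γ w i s ≤ trop γ w s :=
  Finset.le_sup' (fun i => line γ w i s) (Finset.mem_univ i)

/-- the max is attained -/
theorem exists_line_eq_trop (s : ℝ) : ∃ i, line γ w i s = trop γ w s := by
  obtain ⟨i, _, hi⟩ := Finset.exists_mem_eq_sup' (Finset.univ_nonempty (α := ι)) (fun i => line γ w i s)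
  exact ⟨i, hi.symm⟩

/-- `trop ≤ b` iff every line is `≤ b` -/
theorem trop_le_iff (s b : ℝ) : trop γ w s ≤ b ↔ ∀ i, line γ w i s ≤ b := by
  unfold trop
  rw [Finset.sup'_le_iff]
  simp

/-- `0 < F_Λ` -/
theorem psum_pos (Λ s : ℝ) : 0 < psum γ w Λ s :=
  Finset.sum_pos (fun _ _ => Real.exp_pos _) Finset.univ_nonempty

/-- lower bound: the maximal term alone -/
theorem exp_trop_le_psum {Λ : ℝ} (s : ℝ) : Real.exp (Λ * trop γ w s) ≤ psum γ w Λ s := by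
  obtain ⟨i, hi⟩ := exists_line_eq_trop γ w s
  unfold psum
  rw [← hi]
  exact Finset.single_le_sum (f := fun j => Real.exp (Λ * line γ w j s)) (fun j _ => (Real.exp_pos _).le)
    (Finset.mem_univ i)

/-- upper bound: every term is at most the maximal one -/
theorem psum_le_card_mul_exp_trop {Λ : ℝ} (hΛ : 0 ≤ Λ) (s : ℝ) :
    psum γ w Λ s ≤ Fintype.card ι * Real.exp (Λ * trop γ w s) := by
  unfold psum
  calc ∑ i, Real.exp (Λ * line γ w i s) ≤ ∑ _i : ι, Real.exp (Λ * trop γ w s) :=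
        Finset.sum_le_sum fun i _ => Real.exp_le_exp.2 (mul_le_mul_of_nonneg_left (line_le_trop γ w i s) hΛ)
    _ = Fintype.card ι * Real.exp (Λ * trop γ w s) := by simp

/-- **Second difference at a breakpoint.** If `s` is a breakpoint then `L(s+η) + L(s−η) ≥ 2L(s) + η` for
`η ≥ 0` (integer slopes: the slope jump is at least one). -/
theorem two_trop_add_le_of_isBreakpoint {s η : ℝ} (hs : IsBreakpoint γ w s) (hη : 0 ≤ η) :
    2 * trop γ w s + η ≤ trop γ w (s + η) + trop γ w (s - η) := by
  obtain ⟨i, j, hij, hi, hj⟩ := hs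
  have h1 : line γ w j (s + η) ≤ trop γ w (s + η) := line_le_trop γ w j _
  have h2 : line γ w i (s - η) ≤ trop γ w (s - η) := line_le_trop γ w i _
  have hw : (w i : ℝ) + 1 ≤ (w j : ℝ) := by exact_mod_cast hij
  simp only [line] at h1 h2 hi hj
  nlinarith

end Basic

section Free

variable (γ : ι → ℝ) (w : ι → ℕ)

/-- **No breakpoint on `[u,v]` ⇒ `L` is a single line there.** Finite descent: take a maximiser `i` at `u` of
largest slope; if some line beats `ℓ_i` inside the interval, the steeper lines crossing `ℓ_i` inside `(u,v]`
form a nonempty finite set, and at the LEAST crossing abscissa `ℓ_i` is still maximal, so that point is a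
breakpoint. -/
theorem exists_affine_of_free {u v : ℝ}
    (hfree : ∀ x ∈ Set.Icc u v, ¬ IsBreakpoint γ w x) :
    ∃ i, ∀ x ∈ Set.Icc u v, trop γ w x = line γ w i x := by
  classical
  -- maximisers at u, and one of largest slope
  set M : Finset ι := Finset.univ.filter (fun i => line γ w i u = trop γ w u) with hM
  have hMne : M.Nonempty := by
    obtain ⟨i, hi⟩ := exists_line_eq_trop γ w u
    exact ⟨i, by simp [hM, hi]⟩
  obtain ⟨i, hiM, himax⟩ := Finset.exists_max_image M (fun i => w i) hMne
  have hiu : line γ w i u = trop γ w u := by simpa [hM] using hiM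
  -- no maximiser at u is steeper than i (else u itself is a breakpoint)
  have hsteep : ∀ m, line γ w m u = trop γ w u → w m ≤ w i := fun m hm => himax m (by simp [hM, hm])
  refine ⟨i, ?_⟩
  by_contra hcon
  push Not at hcon
  obtain ⟨x, hx, hne⟩ := hcon
  have hlt : line γ w i x < trop γ w x := lt_of_le_of_ne (line_le_trop γ w i x) (Ne.symm hne)
  obtain ⟨m, hm⟩ := exists_line_eq_trop γ w x
  -- m is steeper than i and strictly below ℓ_i at u
  have key : ∀ m', line γ w i x < line γ w m' x → (w i < w m' ∧ line γ w m' u < line γ w i u) := by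
    intro m' hm'
    have hmu : line γ w m' u ≤ line γ w i u := hiu ▸ line_le_trop γ w m' u
    by_cases hw : w m' ≤ w i
    · exfalso
      have hwr : (w m' : ℝ) ≤ w i := by exact_mod_cast hw
      simp only [line] at hm' hmu
      nlinarith [hx.1]
    · push Not at hw
      refine ⟨hw, lt_of_le_of_ne hmu fun heq => ?_⟩
      exact absurd (hsteep m' (heq.trans hiu)) (not_le.2 hw)
  -- crossing abscissa of ℓ_j with ℓ_i (for steeper j)
  set cross : ι → ℝ := fun j => (γ i - γ j) / ((w j : ℝ) - w i) with hcross
  have cross_spec : ∀ j, w i < w j → ∀ y, (line γ w i y < line γ w j y ↔ cross j < y) ∧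
      (line γ w j y < line γ w i y ↔ y < cross j) ∧ (line γ w j y = line γ w i y ↔ y = cross j) := by
    intro j hj y
    have hpos : (0 : ℝ) < (w j : ℝ) - w i := by
      have : (w i : ℝ) < w j := by exact_mod_cast hj
      linarith
    simp only [hcross, line]
    refine ⟨?_, ?_, ?_⟩
    · rw [div_lt_iff₀ hpos]; constructor <;> intro h <;> nlinarith
    · rw [lt_div_iff₀ hpos]; constructor <;> intro h <;> nlinarith
    · rw [eq_div_iff hpos.ne']; constructor <;> intro h <;> linarith
  -- candidates: steeper lines crossing ℓ_i inside (u, v]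
  set Cands : Finset ι := Finset.univ.filter (fun j => w i < w j ∧ u < cross j ∧ cross j ≤ v) with hCands
  have hmC : m ∈ Cands := by
    obtain ⟨hw, hmu⟩ := key m (hm ▸ hlt)
    have h1 : u < cross m := ((cross_spec m hw u).2.1).1 hmu
    have h2 : cross m < x := ((cross_spec m hw x).1).1 (hm ▸ hlt)
    simp only [hCands, Finset.mem_filter, Finset.mem_univ, true_and]
    exact ⟨hw, h1, by linarith [hx.2]⟩
  obtain ⟨j, hjC, hjmin⟩ := Finset.exists_min_image Cands cross ⟨m, hmC⟩
  simp only [hCands, Finset.mem_filter, Finset.mem_univ, true_and] at hjC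
  obtain ⟨hwj, hcu, hcv⟩ := hjC
  set c := cross j with hc
  -- at c, ℓ_i is maximal
  have hic : trop γ w c ≤ line γ w i c := by
    rw [trop_le_iff]
    intro m'
    by_contra hgt
    push Not at hgt
    have hkey : w i < w m' ∧ line γ w m' u < line γ w i u := by
      have hmu : line γ w m' u ≤ line γ w i u := hiu ▸ line_le_trop γ w m' u
      by_cases hw : w m' ≤ w i
      · exfalso
        have hwr : (w m' : ℝ) ≤ w i := by exact_mod_cast hw
        simp only [line] at hgt hmu
        nlinarith [hcu.le]
      · push Not at hw
        exact ⟨hw, lt_of_le_of_ne hmu fun heq => absurd (hsteep m' (heq.trans hiu)) (not_le.2 hw)⟩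
    obtain ⟨hw', hm'u⟩ := hkey
    have h1 : cross m' < c := ((cross_spec m' hw' c).1).1 hgt
    have h2 : u < cross m' := ((cross_spec m' hw' u).2.1).1 hm'u
    have hm'C : m' ∈ Cands := by
      simp only [hCands, Finset.mem_filter, Finset.mem_univ, true_and]
      exact ⟨hw', h2, by linarith⟩
    exact absurd (hjmin m' hm'C) (not_le.2 h1)
  have hic' : line γ w i c = trop γ w c := le_antisymm (line_le_trop γ w i c) hic
  have hjc : line γ w j c = line γ w i c := ((cross_spec j hwj c).2.2).2 rfl
  exact hfree c ⟨hcu.le, hcv⟩ ⟨i, j, hwj, hic', hjc.trans hic'⟩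

/-- On a breakpoint-free window the second difference of `L` vanishes. -/
theorem trop_add_trop_eq_of_free {u η : ℝ} (hη : 0 ≤ η)
    (hfree : ∀ x ∈ Set.Icc (u - η) (u + η), ¬ IsBreakpoint γ w x) :
    trop γ w (u + η) + trop γ w (u - η) = 2 * trop γ w u := by
  obtain ⟨i, hi⟩ := exists_affine_of_free γ w hfree
  rw [hi (u + η) ⟨by linarith, le_rfl⟩, hi (u - η) ⟨le_rfl, by linarith⟩, hi u ⟨by linarith, by linarith⟩]
  simp only [line]
  ring

end Free

section Bump

variable (γ : ι → ℝ) (w : ι → ℕ)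

/-- the numerical heart: `|ι|² < e^{Λη/2}` once `4 log |ι| < Λη` -/
theorem card_sq_lt_exp {Λ η : ℝ} (hbig : 4 * Real.log (Fintype.card ι) < Λ * η) :
    ((Fintype.card ι : ℝ)) ^ 2 < Real.exp (Λ * η / 2) := by
  have hP : (0 : ℝ) < Fintype.card ι := by exact_mod_cast Fintype.card_pos
  rw [← Real.exp_log (pow_pos hP 2), Real.log_pow, Real.exp_lt_exp]
  push_cast
  linarith

/-- **The bump is negative at every breakpoint.** -/
theorem bump_neg_of_isBreakpoint {Λ η s : ℝ} (hΛ : 0 ≤ Λ) (hη : 0 ≤ η)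
    (hbig : 4 * Real.log (Fintype.card ι) < Λ * η) (hs : IsBreakpoint γ w s) :
    psum γ w Λ s ^ 2 - Real.exp (-(Λ * η / 2)) * psum γ w Λ (s + η) * psum γ w Λ (s - η) < 0 := by
  have hP := card_sq_lt_exp (ι := ι) hbig
  have h2 := two_trop_add_le_of_isBreakpoint γ w hs hη
  have hup := psum_le_card_mul_exp_trop γ w hΛ s
  have hlo1 := exp_trop_le_psum γ w (Λ := Λ) (s + η)
  have hlo2 := exp_trop_le_psum γ w (Λ := Λ) (s - η)
  have hpos0 := psum_pos γ w Λ s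
  set E := Real.exp (Λ * trop γ w s) with hE
  have hEpos : 0 < E := Real.exp_pos _
  -- psum s ^ 2 ≤ card^2 * E^2
  have hsq : psum γ w Λ s ^ 2 ≤ (Fintype.card ι : ℝ) ^ 2 * E ^ 2 := by
    have : psum γ w Λ s ≤ Fintype.card ι * E := hup
    have h0 : 0 ≤ psum γ w Λ s := hpos0.le
    nlinarith
  -- product of the shifted sums ≥ exp(Λ (2 L + η)) = E^2 * exp(Λ η)
  have hprod : E ^ 2 * Real.exp (Λ * η) ≤ psum γ w Λ (s + η) * psum γ w Λ (s - η) := by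
    have hmul : Real.exp (Λ * trop γ w (s + η)) * Real.exp (Λ * trop γ w (s - η)) ≤
        psum γ w Λ (s + η) * psum γ w Λ (s - η) :=
      mul_le_mul hlo1 hlo2 (Real.exp_pos _).le (psum_pos γ w Λ _).le
    rw [← Real.exp_add] at hmul
    refine le_trans ?_ hmul
    have hE2 : E ^ 2 * Real.exp (Λ * η) = Real.exp (Λ * (2 * trop γ w s + η)) := by
      rw [hE, sq, ← Real.exp_add, ← Real.exp_add]
      ring_nf
    rw [hE2, Real.exp_le_exp]
    have := mul_le_mul_of_nonneg_left h2 hΛ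
    calc Λ * (2 * trop γ w s + η) ≤ Λ * (trop γ w (s + η) + trop γ w (s - η)) := this
      _ = Λ * trop γ w (s + η) + Λ * trop γ w (s - η) := by ring
  -- combine
  have hexp : Real.exp (-(Λ * η / 2)) * (E ^ 2 * Real.exp (Λ * η)) = E ^ 2 * Real.exp (Λ * η / 2) := by
    rw [mul_comm, mul_assoc, ← Real.exp_add]
    congr 1
    ring_nf
  have hstep : Real.exp (-(Λ * η / 2)) * (E ^ 2 * Real.exp (Λ * η)) ≤
      Real.exp (-(Λ * η / 2)) * psum γ w Λ (s + η) * psum γ w Λ (s - η) := by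
    rw [mul_assoc]
    exact mul_le_mul_of_nonneg_left hprod (Real.exp_pos _).le
  rw [hexp] at hstep
  have hE2 : 0 < E ^ 2 := by positivity
  nlinarith [mul_lt_mul_of_pos_left hP hE2]

/-- **The bump is positive at every point whose `η`-window is breakpoint-free.** -/
theorem bump_pos_of_free {Λ η u : ℝ} (hΛ : 0 ≤ Λ) (hη : 0 ≤ η)
    (hbig : 4 * Real.log (Fintype.card ι) < Λ * η)
    (hfree : ∀ x ∈ Set.Icc (u - η) (u + η), ¬ IsBreakpoint γ w x) :
    0 < psum γ w Λ u ^ 2 - Real.exp (-(Λ * η / 2)) * psum γ w Λ (u + η) * psum γ w Λ (u - η) := by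
  have hP := card_sq_lt_exp (ι := ι) hbig
  have h2 := trop_add_trop_eq_of_free γ w hη hfree
  have hlo := exp_trop_le_psum γ w (Λ := Λ) u
  have hup1 := psum_le_card_mul_exp_trop γ w hΛ (u + η)
  have hup2 := psum_le_card_mul_exp_trop γ w hΛ (u - η)
  set E := Real.exp (Λ * trop γ w u) with hE
  have hEpos : 0 < E := Real.exp_pos _
  have hsq : E ^ 2 ≤ psum γ w Λ u ^ 2 := by
    have h0 : 0 ≤ E := hEpos.le
    nlinarith
  have hprod : psum γ w Λ (u + η) * psum γ w Λ (u - η) ≤ (Fintype.card ι : ℝ) ^ 2 * E ^ 2 := by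
    have hmul : psum γ w Λ (u + η) * psum γ w Λ (u - η) ≤
        (Fintype.card ι * Real.exp (Λ * trop γ w (u + η))) * (Fintype.card ι * Real.exp (Λ * trop γ w (u - η))) :=
      mul_le_mul hup1 hup2 (psum_pos γ w Λ _).le (by positivity)
    refine hmul.trans (le_of_eq ?_)
    rw [hE, mul_mul_mul_comm, ← Real.exp_add, ← mul_add, h2, pow_two, pow_two, ← Real.exp_add]
    ring_nf
  have hstep : Real.exp (-(Λ * η / 2)) * psum γ w Λ (u + η) * psum γ w Λ (u - η) ≤
      Real.exp (-(Λ * η / 2)) * ((Fintype.card ι : ℝ) ^ 2 * E ^ 2) := by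
    rw [mul_assoc]
    exact mul_le_mul_of_nonneg_left hprod (Real.exp_pos _).le
  -- exp(-Λη/2) * card^2 < 1
  have hsmall : Real.exp (-(Λ * η / 2)) * (Fintype.card ι : ℝ) ^ 2 < 1 := by
    rw [Real.exp_neg, inv_mul_lt_iff₀ (Real.exp_pos _), mul_one]
    exact hP
  have hE2 : 0 < E ^ 2 := by positivity
  nlinarith [mul_lt_mul_of_pos_right hsmall hE2]

end Bump

section Poly

open Polynomial

variable (γ : ι → ℝ) (w : ι → ℕ)

/-- the positive lacunary polynomial `f_A(e^{η}·t)·(shift η)`: `Σ_i e^{Λγ_i} e^{ηΛw_i} t^{Λ w_i}`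
(`η = 0` is `f_A` itself). -/
noncomputable def posPolyShift (Λ : ℕ) (η : ℝ) : ℝ[X] :=
  ∑ i, Polynomial.C (Real.exp (Λ * γ i) * Real.exp (η * (Λ * w i))) * Polynomial.X ^ (Λ * w i)

omit [Nonempty ι] in
/-- `f_A(e^{η} e^{s}) = F_Λ(s + η)` -/
theorem posPolyShift_eval_exp (Λ : ℕ) (η s : ℝ) :
    (posPolyShift γ w Λ η).eval (Real.exp s) = psum γ w Λ (s + η) := by
  unfold posPolyShift psum
  rw [Polynomial.eval_finsetSum]
  refine Finset.sum_congr rfl fun i _ => ?_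
  rw [Polynomial.eval_mul, Polynomial.eval_C, Polynomial.eval_pow, Polynomial.eval_X, ← Real.exp_nat_mul,
    ← Real.exp_add, ← Real.exp_add]
  congr 1
  simp only [line]
  push_cast
  ring

/-- the bump polynomial `f_A(t)² − e^{−Λη/2} f_A(e^{η}t) f_A(e^{−η}t)` -/
noncomputable def bumpPoly (Λ : ℕ) (η : ℝ) : ℝ[X] :=
  posPolyShift γ w Λ 0 ^ 2 -
    Polynomial.C (Real.exp (-(Λ * η / 2))) * posPolyShift γ w Λ η * posPolyShift γ w Λ (-η)

omit [Nonempty ι] in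
/-- `f(e^s) = F_Λ(s)² − e^{−Λη/2} F_Λ(s+η) F_Λ(s−η)` -/
theorem bumpPoly_eval_exp (Λ : ℕ) (η s : ℝ) :
    (bumpPoly γ w Λ η).eval (Real.exp s) =
      psum γ w Λ s ^ 2 - Real.exp (-(Λ * η / 2)) * psum γ w Λ (s + η) * psum γ w Λ (s - η) := by
  unfold bumpPoly
  simp only [Polynomial.eval_sub, Polynomial.eval_pow, Polynomial.eval_mul, Polynomial.eval_C,
    posPolyShift_eval_exp, add_zero, ← sub_eq_add_neg]

/-- **Breakpoints become roots.** Along a strictly increasing sequence `σ_0 < σ_1 < ⋯ < σ_{2N}` whose odd-indexed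
points are breakpoints and whose even-indexed points have breakpoint-free `η`-windows, the bump polynomial
alternates in sign at `t = e^{σ_j}`; hence it has at least `2N` distinct positive roots. -/
theorem two_mul_le_card_posRoots_bumpPoly (Λ : ℕ) {η : ℝ} (hη : 0 ≤ η)
    (hbig : 4 * Real.log (Fintype.card ι) < Λ * η) (N : ℕ) (σ : Fin (2 * N + 1) → ℝ) (hσ : StrictMono σ)
    (hbp : ∀ j : Fin (2 * N + 1), Odd j.val → IsBreakpoint γ w (σ j))
    (hfr : ∀ j : Fin (2 * N + 1), Even j.val → ∀ x ∈ Set.Icc (σ j - η) (σ j + η), ¬ IsBreakpoint γ w x) :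
    2 * N ≤ ((bumpPoly γ w Λ η).roots.toFinset.filter (fun t => 0 < t)).card := by
  have hΛ : (0 : ℝ) ≤ (Λ : ℝ) := Nat.cast_nonneg Λ
  -- sign of the bump at σ j, by parity
  have hsign : ∀ j : Fin (2 * N + 1),
      (Even j.val → 0 < (bumpPoly γ w Λ η).eval (Real.exp (σ j))) ∧
      (Odd j.val → (bumpPoly γ w Λ η).eval (Real.exp (σ j)) < 0) := by
    intro j
    refine ⟨fun hj => ?_, fun hj => ?_⟩
    · rw [bumpPoly_eval_exp]
      exact bump_pos_of_free γ w hΛ hη hbig (hfr j hj)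
    · rw [bumpPoly_eval_exp]
      exact bump_neg_of_isBreakpoint γ w hΛ hη hbig (hbp j hj)
  refine Summit.ValiantsHypothesis.ValiantsHypothesis.Theorems.SymmetroidDescartes.le_card_posRoots_of_alternating
    _ (2 * N) (fun j => Real.exp (σ j)) (fun a b h => Real.exp_lt_exp.2 (hσ h)) (fun j => Real.exp_pos _) ?_
  intro j
  have hcs : (j.castSucc : Fin (2 * N + 1)).val = j.val := rfl
  have hsc : (j.succ : Fin (2 * N + 1)).val = j.val + 1 := rfl
  rcases Nat.even_or_odd j.val with hj | hj
  · have h1 := (hsign j.castSucc).1 (hcs ▸ hj)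
    have h2 := (hsign j.succ).2 (hsc ▸ hj.add_one)
    exact mul_neg_of_pos_of_neg h1 h2
  · have h1 := (hsign j.castSucc).2 (hcs ▸ hj)
    have h2 := (hsign j.succ).1 (hsc ▸ hj.add_one)
    exact mul_neg_of_neg_of_pos h1 h2

end Poly

end Summit.ValiantsHypothesis.ValiantsHypothesis.Theorems.DerivedPencilRolle.Negative
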